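import Mathlib
import Summits.Ventures.DiscreteObjects.Mahler.CensusSearchCutsVerdict

/-!
# Node assembly by a frontier walk (venture `DiscreteObjects`, target L)

Cell `pub-namedobj`, seat `pub-namedobj-mahler-g23` (pipeline of seats g12–g22). Framing: lottery ticket; floor = certified bounds/negative
ranges.

The kernel census of a degree `2d` (`censusSearchC`, mahler g13) is proved part by part: every part certifies the subtrees of a few search
nodes `pre` (`∀ a ∈ censusSearchC T CT (d - |pre|) pre (psumsRev pre |pre|), P a`).  Up to degree 26 the parts were re-assembled into the root
statement by one node lemma per internal search node (`mem_censusSearchC_node_iff`, hundreds of lemmas in separate "subtree" files, each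
costing a build-lane round trip).  This file replaces them by ONE computation: `frontierOK T CT F fuel pre ps` walks the internal levels of the
search from `pre` (exactly the children ranges `nodeLoC … nodeHiC` of `censusSearchC`) and checks that every path reaches a prefix listed in the
per-depth table `F`; `forall_censusSearchC_of_frontierOK` concludes the subtree statement for `pre` from the statements of the listed prefixes.
Infrastructure only; no census row is claimed here (first use: `SubLehmerDegreeTwentyEight`, mahler g23, which carries a private copy in its
namespace `W27` because it was filed before this module).
-/

namespace Summit.Ventures.DiscreteObjects.Mahler

open Polynomial

/-- **Frontier walk** (mahler g23): descend the internal levels of `censusSearchC` from the node `(pre, ps)` for at most `fuel` levels,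
stopping at every prefix listed in the per-depth table `F` (`F.getD k []` = the stopping prefixes of length `k`); `true` iff every
path stops inside `F` (a node whose fuel is exhausted and which is not listed fails). -/
def frontierOK (T : List ℕ) (CT : List (List (List ℤ × ℤ))) (F : List (List (List ℤ))) : ℕ → List ℤ → List ℤ → Bool
  | 0, pre, _ => decide (pre ∈ F.getD pre.length [])
  | fuel + 1, pre, ps =>
    decide (pre ∈ F.getD pre.length []) ||
      (icc (nodeLoC T CT pre ps) (nodeHiC T CT pre ps)).all fun ak => frontierOK T CT F fuel (pre ++ [ak]) (nodeP pre ps ak :: ps)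

/-- An entry of some row of the per-depth table is an entry of the flattened table. -/
theorem mem_flatten_of_mem_getD {α : Type*} {F : List (List α)} {n : ℕ} {q : α} (h : q ∈ F.getD n []) : q ∈ F.flatten := by
  rw [List.getD_eq_getElem?_getD] at h
  cases hn : F[n]? with
  | none => rw [hn, Option.getD_none] at h; simp at h
  | some v => rw [hn, Option.getD_some] at h; exact List.mem_flatten.2 ⟨v, List.mem_of_getElem? hn, h⟩

/-- **Node assembly by a frontier walk** (mahler g23; replaces the per-node assembly lemmas of the subtree files): if every listed
frontier prefix `q` has a certified subtree (`∀ a ∈ censusSearchC T CT (d - |q|) q (psumsRev q |q|), P a`) and the walk from `pre`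
(`|pre| + fuel = d`) stops inside the table everywhere, then the subtree of `pre` is certified. -/
theorem forall_censusSearchC_of_frontierOK {T : List ℕ} {CT : List (List (List ℤ × ℤ))} {F : List (List (List ℤ))}
    {P : List ℤ → Prop} {d : ℕ}
    (hF : ∀ q ∈ F.flatten, ∀ a ∈ censusSearchC T CT (d - q.length) q (psumsRev q q.length), P a) :
    ∀ (fuel : ℕ) (pre : List ℤ), pre.length + fuel = d →
      frontierOK T CT F fuel pre (psumsRev pre pre.length) = true →
      ∀ a ∈ censusSearchC T CT fuel pre (psumsRev pre pre.length), P a := by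
  intro fuel
  induction fuel with
  | zero =>
    intro pre hd hok a ha
    simp only [frontierOK, decide_eq_true_eq] at hok
    have h := hF pre (mem_flatten_of_mem_getD hok)
    rw [show d - pre.length = 0 by omega] at h
    exact h a ha
  | succ fuel ih =>
    intro pre hd hok a ha
    simp only [frontierOK, Bool.or_eq_true, decide_eq_true_eq, List.all_eq_true] at hok
    rcases hok with hmem | hall
    · have h := hF pre (mem_flatten_of_mem_getD hmem)
      rw [show d - pre.length = fuel + 1 by omega] at h
      exact h a ha
    · rw [mem_censusSearchC_node_iff rfl] at ha
      obtain ⟨ak, hak, ha⟩ := ha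
      have hlen : (pre ++ [ak]).length = pre.length + 1 := by simp
      have hok' := hall ak hak
      rw [← psumsRev_append_single] at hok'
      have := ih (pre ++ [ak]) (by rw [hlen]; omega) (by rw [hlen]; exact hok') a (by rw [hlen]; exact ha)
      exact this

/-- The walk from a node of depth `n` (statement shape of the census parts: `psumsRev pre n`). -/
theorem forall_censusSearchC_of_frontierOK' {T : List ℕ} {CT : List (List (List ℤ × ℤ))} {F : List (List (List ℤ))}
    {P : List ℤ → Prop} {d fuel n : ℕ} {pre : List ℤ}
    (hF : ∀ q ∈ F.flatten, ∀ a ∈ censusSearchC T CT (d - q.length) q (psumsRev q q.length), P a)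
    (hn : pre.length = n) (hd : n + fuel = d) (hok : frontierOK T CT F fuel pre (psumsRev pre n) = true) :
    ∀ a ∈ censusSearchC T CT fuel pre (psumsRev pre n), P a := by
  subst hn
  exact forall_censusSearchC_of_frontierOK hF fuel pre hd hok

end Summit.Ventures.DiscreteObjects.Mahler
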